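import Summits.Ventures.Crystal3D.Kissing125.GSearchNode3
import Summits.Ventures.Crystal3D.Kissing125.GSearchRelabel1
import HarnessLib

/-!
# Sides, growth and relabelling in the growth search, κ-generic — part 2/3

HONEST FRAMING (cell pub-crystal3d, K-path at `h = 5/4`, V4 = κ as an explicit parameter): this is NOT a result printed
by Hales; it is his METHOD (arXiv:1209.6043, Theorem 3 + Lemmas 7–10, in the tree's form of a verified interval-arithmetic
growth search, `Literature/…/KissingSearch*.lean`) with the largest long-side cosine `κ` made an EXPLICIT PARAMETER
(`κ : Kappa`, carrying the two numeric facts the soundness proof uses: `-1/2 ≤ κ`, `κ < 1/4`).  Only the declarations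
whose statement depends on `κ` are declared here (namespace `…Kissing125.GSearch`, the tree's short names, no renames);
every κ-free helper is the landed K25 copy (`…Kissing125.KissingSearch.*`) and every κ-free lemma is cited from the tree
(PRIVATE per-file citation aliases; `GSearchTransport.lean` holds `toT : St → tree St` and the transport equalities).  The K25
instance is `κ25 = ⟨7/32, …⟩`; `GSearchBridge.lean` identifies the generic checker at
`κ25` with the landed `Kissing125.KissingSearch.checkPart`, so the landed run files are consumed unchanged.  Generated by
`HOME/lean/kissing125/v4-prep/gen/mkgen.py`; nothing here is asserted about GAP(1.26) or any census.

THIS FILE: the κ-tainted declarations of `Literature/Geometry/DiscreteGeometry/KissingSearchRelabel.lean` (part 2 of 3), with `κ : Kappa` threaded; κ-free declarations of that file are NOT re-declared publicly (the κ-free helpers are the landed K25 copies; the κ-free tree lemmas used by the proofs are cited through PRIVATE aliases at the top of the file).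

## References
* T. C. Hales, *A proof of Fejes Tóth's conjecture on sphere packings with kissing number twelve*,
  arXiv:1209.6043 (2012): Definition 1, Theorem 2, Theorem 3, Lemmas 7–10. [`Hales2012`]
* R. E. Moore, *Interval Analysis* (1966), Theorem 3.1, §4.4. [`Moore1966`]
-/

namespace Summit.Ventures.Crystal3D.Kissing125

open Literature.Geometry.DiscreteGeometry
open Summit.Ventures.Crystal3D.Kissing125.KissingSearch

namespace GSearch

open Real Literature.Analysis.ValidatedNumerics KissingLP NonemptyInterval Finset

variable {κ : Kappa}

/-! ### κ-free tree lemmas used below, read over the K25 copies (PRIVATE citation aliases; the public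
surface of this file is κ-generic only) -/

/-- K25 reading of the tree lemma `cdeg_eq` (κ-free; proof = citation of the tree lemma). [folklore] -/
private theorem cdeg_eq (s : St) (v : ℕ) :
  s.cdeg v = (List.filter (fun u ↦ decide (u ≠ v ∧ s.gdom u v = 0)) (List.range' 0 12)).length :=
  by rw [cdeg_tr]; exact Literature.Geometry.DiscreteGeometry.KissingSearch.cdeg_eq (toT s) v

/-- K25 reading of the tree lemma `gdom_comm` (κ-free; proof = citation of the tree lemma). [folklore] -/
private theorem gdom_comm (s : St) (a b : ℕ) : s.gdom a b = s.gdom b a :=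
  Literature.Geometry.DiscreteGeometry.KissingSearch.gdom_comm (toT s) a b

/-- K25 reading of the tree lemma `hdeg2_eq` (κ-free; proof = citation of the tree lemma). [folklore] -/
private theorem hdeg2_eq (s : St) (v : ℕ) :
  s.hdeg2 v = (List.map (fun u ↦ s.gsc v u) (List.filter (fun u ↦ decide (u ≠ v)) (List.range' 0 12))).sum :=
  by rw [hdeg2_tr]; exact Literature.Geometry.DiscreteGeometry.KissingSearch.hdeg2_eq (toT s) v

/-- K25 reading of the tree lemma `linkSummary_eq` (κ-free; proof = citation of the tree lemma). [folklore] -/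
private theorem linkSummary_eq (s : St) (v : ℕ) :
  s.linkSummary v =
    ((List.filter (fun u ↦ decide (u ≠ v ∧ s.gsc v u ≠ 0)) (List.range' 0 12)).length,
      (List.filter (fun u ↦ decide (u ≠ v ∧ s.gsc v u = 1)) (List.range' 0 12)).length,
      (List.range' 0 12).any fun u ↦ decide (u ≠ v ∧ 3 ≤ s.gsc v u),
      (List.filter (fun u ↦ decide (u ≠ v ∧ s.gsc v u ≠ 0)) (List.range' 0 12)).reverse) :=
  by rw [linkSummary_tr]; exact Literature.Geometry.DiscreteGeometry.KissingSearch.linkSummary_eq (toT s) v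

/-- K25 reading of the tree lemma `lt_of_mem_tset` (κ-free; proof = citation of the tree lemma). [folklore] -/
private theorem lt_of_mem_tset {t v : ℕ} (ht : TriValid t) (hv : v ∈ tset t) : v < 12 :=
  Literature.Geometry.DiscreteGeometry.KissingSearch.lt_of_mem_tset ht hv

/-- K25 reading of the tree lemma `nlong_eq` (κ-free; proof = citation of the tree lemma). [folklore] -/
private theorem nlong_eq (s : St) :
  s.nlong =
    (List.filter (fun i ↦ decide (i / 12 < i % 12 ∧ s.dom.getD i UNL ≠ 0 ∧ s.dom.getD i UNL ≠ UNL))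
        (List.range' 0 144)).length :=
  by rw [nlong_tr]; exact Literature.Geometry.DiscreteGeometry.KissingSearch.nlong_eq (toT s)

/-- K25 reading of the tree lemma `others_spec` (κ-free; proof = citation of the tree lemma). [folklore] -/
private theorem others_spec {t v : ℕ} (ht : TriValid t) (hv : v ∈ tset t) :
  v ≠ (others t v).1 ∧
    v ≠ (others t v).2 ∧ (others t v).1 ≠ (others t v).2 ∧ tset t = {v, (others t v).1, (others t v).2} :=
  Literature.Geometry.DiscreteGeometry.KissingSearch.others_spec ht hv

/-- K25 reading of the tree lemma `sIdx_div_mod` (κ-free; proof = citation of the tree lemma). [folklore] -/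
private theorem sIdx_div_mod {a b : ℕ} (ha : a < 12) (hb : b < 12) :
  sIdx a b / 12 = min a b ∧ sIdx a b % 12 = max a b :=
  Literature.Geometry.DiscreteGeometry.KissingSearch.sIdx_div_mod ha hb

/-- K25 reading of the tree lemma `tmem_iff` (κ-free; proof = citation of the tree lemma). [folklore] -/
private theorem tmem_iff {t v : ℕ} : tmem t v = true ↔ v ∈ tset t :=
  Literature.Geometry.DiscreteGeometry.KissingSearch.tmem_iff

/-- K25 reading of the tree lemma `validDom_mkR` (κ-free; proof = citation of the tree lemma). [folklore] -/
private theorem validDom_mkR {lo hi : ℕ} (h1 : 1 ≤ lo) (h2 : lo ≤ hi) (h3 : hi ≤ K) :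
  ValidDom (mkR lo hi) :=
  Literature.Geometry.DiscreteGeometry.KissingSearch.validDom_mkR h1 h2 h3


section Grow
variable {M : KConf κ} {s : St}
/-- Under the root normalisation, the closed-root kill never fires: when every side at `0` lies in
`0` or `2` placed triangles, all triangles of `M` at `0` are placed, so the four contacts of `0`
are labelled and counted. [folklore] -/
theorem rootKill_false {M : KConf κ} {s : St} (hR : Realizes M s) (hI : M.RootInv) : s.rootKill = false := by
  classical
  unfold St.rootKill
  rw [show s.linkSummary 0 = ((s.linkSummary 0).1, (s.linkSummary 0).2.1, (s.linkSummary 0).2.2.1, (s.linkSummary 0).2.2.2)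
    from rfl]
  simp only
  rw [linkSummary_eq]
  simp only
  by_contra h
  rw [Bool.not_eq_false] at h
  simp only [Bool.and_eq_true, bne_iff_ne, ne_eq, beq_iff_eq] at h
  obtain ⟨⟨hnv, hne⟩, hc⟩ := h
  apply hc
  -- all triangles at `0` are placed
  have hne' : ∀ u, u < 12 → u ≠ 0 → s.gsc 0 u ≠ 1 := by
    intro u hu hu0 h1
    have : u ∈ (List.range' 0 12).filter (fun u => u ≠ 0 ∧ s.gsc 0 u = 1) := by
      simp only [List.mem_filter, List.mem_range'_1, decide_eq_true_eq]; exact ⟨by omega, hu0, h1⟩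
    rw [List.length_eq_zero_iff.1 hne] at this; simp at this
  obtain ⟨u₀, hu₀⟩ := List.exists_mem_of_ne_nil ((List.range' 0 12).filter fun u => u ≠ 0 ∧ s.gsc 0 u ≠ 0)
    (fun e => hnv (by rw [e]; rfl))
  simp only [List.mem_filter, List.mem_range'_1, decide_eq_true_eq] at hu₀
  obtain ⟨hu₀12, hu₀0, hg₀⟩ := hu₀
  rw [gsc_eq_length hR (by norm_num) (by omega) (Ne.symm hu₀0)] at hg₀
  obtain ⟨t₀, ht₀⟩ := List.exists_mem_of_ne_nil (s.onSideL 0 u₀) (fun e => hg₀ (by rw [e]; rfl))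
  unfold St.onSideL at ht₀; rw [List.mem_filter] at ht₀; simp only [Bool.and_eq_true] at ht₀
  have placed : ∀ t'' ∈ M.T, 0 ∈ t'' → ∃ t ∈ s.tris.toList, tset t = t'' :=
    fun t'' hT h0 => all_placed_of_closed hR (by norm_num) hne' ht₀.1 (tmem_iff.1 ht₀.2.1) hT h0
  -- the contacts of `0` are exactly the labels with contact code
  rw [cdeg_eq, ← hI.1, ← List.toFinset_card_of_nodup (List.Nodup.filter _ List.nodup_range')]
  congr 1
  ext u
  rw [List.mem_toFinset, List.mem_filter, List.mem_range'_1, Finset.mem_filter, Finset.mem_range]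
  simp only [decide_eq_true_eq]
  constructor
  · rintro ⟨hu, hu0, h0⟩
    refine ⟨by omega, hu0, ?_⟩
    rcases hR.dom u 0 (by omega) (by norm_num) hu0 with h | ⟨-, h⟩ | ⟨-, h, -⟩
    · rw [h0] at h; exact absurd h (by unfold UNL; norm_num)
    · rw [M.g_symm]; exact h
    · exact absurd h0 h
  · rintro ⟨hu, hu0, hg⟩
    refine ⟨by omega, hu0, ?_⟩
    obtain ⟨t'', hT, h0t, hut⟩ := M.contact_side 0 u (by norm_num) hu (Ne.symm hu0) hg
    obtain ⟨t, ht, e⟩ := placed t'' hT h0t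
    have hl := hR.side_lab t ht 0 (by rw [e]; exact h0t) u (by rw [e]; exact hut) (Ne.symm hu0)
    rw [gdom_comm] at hl
    rcases hR.dom u 0 (by omega) (by norm_num) hu0 with h | ⟨h, -⟩ | ⟨-, -, h, -⟩
    · exact absurd h hl
    · exact h
    · rw [M.g_symm] at hg; exact absurd hg h

/-- **A label is used iff `hdeg2 ≠ 0`.** [folklore] -/
theorem used_iff_hdeg2 {M : KConf κ} {s : St} (hR : Realizes M s) {v : ℕ} (hv : v < 12) :
    (∃ t ∈ s.tris.toList, v ∈ tset t) ↔ s.hdeg2 v ≠ 0 := by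
  rw [hdeg2_eq]
  constructor
  · rintro ⟨t, ht, hvt⟩
    obtain ⟨n1, -, -, hset⟩ := others_spec (hR.valid t ht) hvt
    set u := (others t v).1
    have hu : u ∈ tset t := by rw [hset]; simp
    have hu12 := lt_of_mem_tset (hR.valid t ht) hu
    have hpos : 0 < s.gsc v u := by
      rw [gsc_eq_length hR hv hu12 n1]
      apply List.length_pos_of_mem (a := t)
      unfold St.onSideL; rw [List.mem_filter]; simp only [Bool.and_eq_true]
      exact ⟨ht, tmem_iff.2 hvt, tmem_iff.2 hu⟩
    intro h0
    have hmem : s.gsc v u ∈ ((List.range' 0 12).filter fun u => u ≠ v).map fun u => s.gsc v u := by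
      rw [List.mem_map]
      refine ⟨u, ?_, rfl⟩
      rw [List.mem_filter, List.mem_range'_1]; simp only [decide_eq_true_eq]; exact ⟨by omega, n1.symm⟩
    have := List.single_le_sum (fun _ _ => Nat.zero_le _) _ hmem
    omega
  · intro h
    obtain ⟨x, hx, hx0⟩ : ∃ x ∈ ((List.range' 0 12).filter fun u => u ≠ v).map (fun u => s.gsc v u), x ≠ 0 := by
      by_contra hall
      push Not at hall
      exact h (List.sum_eq_zero hall)
    rw [List.mem_map] at hx
    obtain ⟨u, hu, rfl⟩ := hx
    rw [List.mem_filter, List.mem_range'_1] at hu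
    simp only [decide_eq_true_eq] at hu
    rw [gsc_eq_length hR hv (by omega) (Ne.symm hu.2)] at hx0
    obtain ⟨t, ht⟩ := List.exists_mem_of_ne_nil (s.onSideL v u) (fun e => hx0 (by rw [e]; rfl))
    unfold St.onSideL at ht; rw [List.mem_filter] at ht; simp only [Bool.and_eq_true] at ht
    exact ⟨t, ht.1, tmem_iff.1 ht.2.1⟩

/-- The true code of a side of a triangle of `M` means the truth. [folklore] -/
theorem domSem_trueCode (hR : Realizes M s) {p q : ℕ} (hp : p < 12) (hq : q < 12) (hpq : p ≠ q)
    {t : Finset ℕ} (hT : t ∈ M.T) (hpt : p ∈ t) (hqt : q ∈ t) :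
    DomSem κ (trueCode M s p q) (M.g p q) ∧ trueCode M s p q ≠ UNL := by
  unfold trueCode
  by_cases hl : s.gdom p q ≠ UNL
  · rw [if_pos hl]; exact ⟨hR.dom p q hp hq hpq, hl⟩
  · rw [if_neg hl]
    by_cases hg : M.g p q = 1 / 2
    · rw [if_pos hg]; exact ⟨Or.inr (Or.inl ⟨rfl, hg⟩), by unfold UNL; norm_num⟩
    · rw [if_neg hg]
      refine ⟨Or.inr (Or.inr ⟨validDom_mkR le_rfl (by unfold K; norm_num) le_rfl, by unfold FULLR mkR; norm_num, hg, ?_, ?_⟩),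
        by unfold FULLR mkR UNL K; norm_num⟩
      · have elo : rLo FULLR = 1 := by unfold rLo FULLR mkR K; norm_num
        rw [elo]
        have : gridPt κ (1 - 1) = -1 / 2 := by unfold gridPt; simp
        rw [this]
        have := M.side_bound t hT p hpt q hqt hpq
        push_cast; linarith
      · have ehi : rHi FULLR = K := by unfold rHi FULLR mkR K; norm_num
        rw [ehi]
        have : gridPt κ K = κ.val := by unfold gridPt K; ring
        rw [this]
        rcases M.dichot p q hp hq hpq with h | ⟨-, h⟩
        · exact absurd h hg
        · exact h

/-- **The true codes are among the label options** (in a realized state, for the two new sides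
of the missing triangle). [cite: Hales2012, Lemma 7] -/
theorem trueCode_mem_labelOpts {M : KConf κ} {s : St} (hR : Realizes M s) {p q : ℕ} (hp : p < 12) (hq : q < 12) (hpq : p ≠ q)
    {t : Finset ℕ} (hT : t ∈ M.T) (hpt : p ∈ t) (hqt : q ∈ t) :
    trueCode M s p q ∈ s.labelOpts p q := by
  classical
  unfold trueCode St.labelOpts
  by_cases hl : s.gdom p q ≠ UNL
  · rw [if_pos hl, if_pos hl]; simp
  · rw [if_neg hl, if_neg hl]
    push Not at hl
    by_cases hg : M.g p q = 1 / 2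
    · rw [if_pos hg]
      -- a fifth contact is impossible at `p` and at `q`
      have key : ∀ {x y : ℕ}, x < 12 → y < 12 → x ≠ y → s.gdom x y = UNL → M.g x y = 1 / 2 → s.cdeg x < 4 := by
        intro x y hx hy hxy hU hgxy
        rw [cdeg_eq]
        by_contra hge
        push Not at hge
        -- the contacts counted, plus `y`, are five distinct contacts of `x`
        have hle := M.cdeg_le x hx
        obtain ⟨Lc, hLc⟩ : ∃ Lc, Lc = (List.range' 0 12).filter fun u => u ≠ x ∧ s.gdom u x = 0 := ⟨_, rfl⟩
        rw [← hLc] at hge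
        have hsub : insert y Lc.toFinset ⊆ (Finset.range 12).filter fun b => b ≠ x ∧ M.g x b = 1 / 2 := by
          intro u hu
          rw [Finset.mem_insert] at hu
          rw [Finset.mem_filter, Finset.mem_range]
          rcases hu with rfl | hu
          · exact ⟨hy, hxy.symm, hgxy⟩
          · rw [List.mem_toFinset, hLc, List.mem_filter, List.mem_range'_1] at hu
            simp only [decide_eq_true_eq] at hu
            obtain ⟨hu12, hux, h0⟩ := hu
            refine ⟨by omega, hux, ?_⟩
            rcases hR.dom u x (by omega) hx hux with h | ⟨-, h⟩ | ⟨-, h, -⟩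
            · rw [h0] at h; exact absurd h (by unfold UNL; norm_num)
            · rw [M.g_symm]; exact h
            · exact absurd h0 h
        have hyL : y ∉ Lc.toFinset := by
          rw [List.mem_toFinset, hLc, List.mem_filter]
          simp only [decide_eq_true_eq, not_and]
          intro _ _
          rw [gdom_comm] at hU; rw [hU]; unfold UNL; norm_num
        have hcard := Finset.card_le_card hsub
        have hnd : Lc.Nodup := by rw [hLc]; exact List.Nodup.filter _ List.nodup_range'
        rw [Finset.card_insert_of_notMem hyL, List.toFinset_card_of_nodup hnd] at hcard
        omega
      have h1 := key hp hq hpq hl hg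
      have h2 := key hq hp hpq.symm (by rw [gdom_comm]; exact hl) (by rw [M.g_symm]; exact hg)
      rw [if_pos ⟨h1, h2⟩]; simp
    · rw [if_neg hg]
      -- an eighth long side is impossible
      have hlt : s.nlong < 7 := by
        rw [nlong_eq]
        by_contra hge
        push Not at hge
        have hle := M.card_longSides_le
        obtain ⟨Ll, hLl⟩ : ∃ Ll, Ll = (List.range' 0 144).filter fun i =>
            i / 12 < i % 12 ∧ s.dom.getD i UNL ≠ 0 ∧ s.dom.getD i UNL ≠ UNL := ⟨_, rfl⟩
        rw [← hLl] at hge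
        -- inject `insert (sIdx p q) Ll` into the long sides
        have hsub : ∀ i ∈ insert (sIdx p q) Ll.toFinset, ({i / 12, i % 12} : Finset ℕ) ∈ M.longSides := by
          intro i hi
          rw [Finset.mem_insert] at hi
          unfold KConf.longSides
          rw [Finset.mem_filter, M.mem_sides]
          rcases hi with rfl | hi
          · obtain ⟨e1, e2⟩ := sIdx_div_mod hp hq
            have hmin : min p q ≠ max p q := by omega
            refine ⟨⟨by rw [e1, e2, Finset.card_pair hmin], t, hT, ?_⟩, min p q, by rw [e1]; simp, max p q,
              by rw [e2]; simp, hmin, ?_⟩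
            · rw [e1, e2]; intro x hx; simp only [Finset.mem_insert, Finset.mem_singleton] at hx
              rcases hx with rfl | rfl
              · rcases le_total p q with h | h
                · rw [min_eq_left h]; exact hpt
                · rw [min_eq_right h]; exact hqt
              · rcases le_total p q with h | h
                · rw [max_eq_right h]; exact hqt
                · rw [max_eq_left h]; exact hpt
            · rcases le_total p q with h | h
              · rw [min_eq_left h, max_eq_right h]; exact hg
              · rw [min_eq_right h, max_eq_left h, M.g_symm]; exact hg
          · rw [List.mem_toFinset, hLl, List.mem_filter, List.mem_range'_1] at hi
            simp only [decide_eq_true_eq] at hi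
            obtain ⟨hi144, hlt', h0, hU⟩ := hi
            have ha12 : i / 12 < 12 := by omega
            have hb12 : i % 12 < 12 := by omega
            have hab : i / 12 ≠ i % 12 := by omega
            have hidx : sIdx (i / 12) (i % 12) = i := by unfold sIdx; rw [if_pos hlt']; omega
            have hgd : s.gdom (i / 12) (i % 12) = s.dom.getD i UNL := by unfold St.gdom; rw [hidx]
            obtain ⟨t', ht', hat, hbt⟩ := hR.lab_side _ _ ha12 hb12 hab (by rw [hgd]; exact hU)
            refine ⟨⟨by rw [Finset.card_pair hab], tset t', hR.mem t' ht', ?_⟩, i / 12, by simp, i % 12, by simp, hab, ?_⟩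
            · intro x hx; simp only [Finset.mem_insert, Finset.mem_singleton] at hx
              rcases hx with rfl | rfl
              · exact hat
              · exact hbt
            · rcases hR.dom _ _ ha12 hb12 hab with h | ⟨h, -⟩ | ⟨-, -, h, -⟩
              · rw [hgd] at h; exact absurd h hU
              · rw [hgd] at h; exact absurd h h0
              · exact h
        have hinj : Set.InjOn (fun i => ({i / 12, i % 12} : Finset ℕ)) (insert (sIdx p q) Ll.toFinset : Finset ℕ) := by
          intro i hi j hj e
          simp only at e
          have h1 : i / 12 ∈ ({j / 12, j % 12} : Finset ℕ) := by rw [← e]; simp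
          have h2 : i % 12 ∈ ({j / 12, j % 12} : Finset ℕ) := by rw [← e]; simp
          simp only [Finset.mem_insert, Finset.mem_singleton] at h1 h2
          -- both have `i/12 < i%12` and `j/12 < j%12`
          have li : i / 12 < i % 12 := by
            rw [Finset.mem_coe, Finset.mem_insert] at hi
            rcases hi with rfl | hi
            · have := sIdx_div_mod hp hq; omega
            · rw [List.mem_toFinset, hLl, List.mem_filter] at hi; simp only [decide_eq_true_eq] at hi; exact hi.2.1
          have lj : j / 12 < j % 12 := by
            rw [Finset.mem_coe, Finset.mem_insert] at hj
            rcases hj with rfl | hj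
            · have := sIdx_div_mod hp hq; omega
            · rw [List.mem_toFinset, hLl, List.mem_filter] at hj; simp only [decide_eq_true_eq] at hj; exact hj.2.1
          omega
        have hnot : sIdx p q ∉ Ll.toFinset := by
          rw [List.mem_toFinset, hLl, List.mem_filter]
          simp only [decide_eq_true_eq, not_and]
          intro _ _ _
          exact fun h => h hl
        have hcard := Finset.card_le_card_of_injOn _ hsub hinj
        have hnd : Ll.Nodup := by rw [hLl]; exact List.Nodup.filter _ List.nodup_range'
        rw [Finset.card_insert_of_notMem hnot, List.toFinset_card_of_nodup hnd] at hcard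
        omega
      rw [if_pos hlt]; simp

end Grow

end GSearch

end Summit.Ventures.Crystal3D.Kissing125
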